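import Summits.ResolutionOfSingularities.ResolutionOfSingularities.Theorems.WildConesClassicalRegimesStubMuDropCharTwoOrdPBlowFam

/-!
# Milnor drop in characteristic two (`stub_muDropCharTwoOrdP`) — helper 3/8: Reduction

Helper file for the stub `stub_muDropCharTwoOrdP` of crux `ClassicalRegimes`
(stmt-ResolutionOfSingularities-16884, route `WildCones`, line `milnor-descent`): the one-step drop
of the Milnor number `μ = dim_κ κ⟦u₁,…,uₙ⟧/(∂a)` of the cleaned state of `z² = a(u)` under the
point-blow-up dynamics in characteristic two, `n ≥ 3`. The proof works on formal power series:
a hyperbolic pair `u_j u_l` of the quadratic part of `a` is split off by the formal coordinate change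
`u_j ↦ q⁻¹ ∂_l a, u_l ↦ q⁻¹ ∂_j a` (formal inverse function theorem; `∂_j ∂_j = 0` in
characteristic two makes `∂_j ã ∈ (u_l)`, `∂_l ã ∈ (u_j)`), which commutes with the strict
transform; killing `u_j, u_l` descends to `n - 2` variables with the same Milnor algebras. The
leaves: `n ≥ 3` residual variables without hyperbolic pair are not isolated (Case A), `n = 1` is
`μ = ord - 1`, and `n = 2` is Max Noether's inequality `I(∂ₓa, ∂_y a) ≥ m m' + I(strict transforms)`
at the point of the exceptional line plus the multiplicity `≤ 3` of that line in `(∂G)`.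
Sources: G.-M. Greuel, G. Pfister, *The splitting lemma in any characteristic*, J. Algebra 689
(2026) = arXiv:2507.17078, Thm. 3.5 / Cor. 3.7 (the hyperbolic pair; only its linear part is used);
E. Casas-Alvero, *Singularities of Plane Curves*, §3 (Noether's formula); folklore otherwise.

This file: the formal coordinate change of a hyperbolic pair: substitutions with invertible linear part are algebra automorphisms (formal inverse function theorem), the pair family `(q⁻¹ ∂_l f, q⁻¹ ∂_j f, X_s)` has unipotent linear part, and after the change `X_l ∣ ∂_j f̃`, `X_j ∣ ∂_l f̃`, `X_j, X_l ∈ (∂f̃)`, `(∂f) = F(∂f̃)`.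
-/

noncomputable section

-- single-problem summit: the doubled namespace component `ResolutionOfSingularities` is forced
set_option linter.dupNamespace false

open scoped BigOperators Classical

open MvPowerSeries IsLocalRing

open Literature.AlgebraicGeometry.Resolution

namespace Summit.ResolutionOfSingularities.ResolutionOfSingularities.Theorems.WildCones

namespace MuDropCharTwoOrdP

variable {κ : Type} [Field κ]

/-! ## Formal coordinate changes: the critical-submanifold reduction of a hyperbolic pair -/

section Reduction

variable {n : ℕ}

/-- A substitution with zero constant terms and invertible linear part is an algebra
AUTOMORPHISM of `κ⟦X₁,…,Xₙ⟧` (formal inverse function theorem). [folklore] -/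
theorem exists_algEquiv_of_subst (θ : Fin n → MvPowerSeries (Fin n) κ)
    (h0 : ∀ s, constantCoeff (θ s) = 0) (hdet : IsUnit (FormalCoordChange.linMat θ).det) :
    ∃ F : MvPowerSeries (Fin n) κ ≃ₐ[κ] MvPowerSeries (Fin n) κ, ∀ f, F f = subst θ f := by
  obtain ⟨ψ, hψ0, hψθ, hθψ⟩ := FormalCoordChange.exists_comp_inverse h0 hdet
  have hθ : HasSubst θ := hasSubst_of_constantCoeff_zero h0
  have hψ : HasSubst ψ := hasSubst_of_constantCoeff_zero hψ0
  have h1 : (substAlgHom hθ).comp (substAlgHom hψ) = AlgHom.id κ _ := by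
    ext f : 1
    rw [AlgHom.comp_apply, substAlgHom_apply, substAlgHom_apply, subst_comp_subst_apply hψ hθ,
      AlgHom.id_apply, show (fun s => subst θ (ψ s)) = X from funext hθψ, subst_self, id]
  have h2 : (substAlgHom hψ).comp (substAlgHom hθ) = AlgHom.id κ _ := by
    ext f : 1
    rw [AlgHom.comp_apply, substAlgHom_apply, substAlgHom_apply, subst_comp_subst_apply hθ hψ,
      AlgHom.id_apply, show (fun s => subst ψ (θ s)) = X from funext hψθ, subst_self, id]
  exact ⟨AlgEquiv.ofAlgHom (substAlgHom hθ) (substAlgHom hψ) h1 h2, fun f => by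
    rw [AlgEquiv.ofAlgHom_apply, substAlgHom_apply]⟩

/-- An algebra automorphism of `κ⟦X⟧` preserves the order filtration `ord ≥ N`. [folklore] -/
theorem le_order_algEquiv (F : MvPowerSeries (Fin n) κ ≃ₐ[κ] MvPowerSeries (Fin n) κ)
    {N : ℕ} {f : MvPowerSeries (Fin n) κ} (hf : (N : ℕ∞) ≤ f.order) : (N : ℕ∞) ≤ (F f).order := by
  rw [Literature.RingTheory.MvPowerSeries.Jets.le_order_iff_mem_maximalIdeal_pow] at hf ⊢
  exact Literature.RingTheory.MvPowerSeries.Jets.algHom_apply_mem_maximalIdeal_pow (F : _ →ₐ[κ] _) hf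

/-- The linear part of the pair family `(q⁻¹ ∂_l f, q⁻¹ ∂_j f, X_s)` is unipotent, hence
invertible (characteristic two: `[X_l] ∂_l f = 2 [X_l²] f = 0`). [folklore] -/
theorem isUnit_det_linMat_pair [CharP κ 2] {f : MvPowerSeries (Fin n) κ} {j l : Fin n}
    (hjl : j ≠ l) (hq : coeff (Finsupp.single j 1 + Finsupp.single l 1) f ≠ 0) :
    IsUnit (FormalCoordChange.linMat (fun s => if s = j then
      (coeff (Finsupp.single j 1 + Finsupp.single l 1) f)⁻¹ • MvPowerSeries.pderiv l f
      else if s = l then (coeff (Finsupp.single j 1 + Finsupp.single l 1) f)⁻¹ • MvPowerSeries.pderiv j f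
      else X s)).det := by
  set q := coeff (Finsupp.single j 1 + Finsupp.single l 1) f with hq'
  set M := FormalCoordChange.linMat (fun s => if s = j then q⁻¹ • MvPowerSeries.pderiv l f
      else if s = l then q⁻¹ • MvPowerSeries.pderiv j f else (X s : MvPowerSeries (Fin n) κ)) with hM
  have h2 : ((1 : ℕ) : κ) + 1 = 0 := by rw [Nat.cast_one]; exact CharTwo.add_self_eq_zero 1
  -- the entries of `E = M - 1`
  have hMst : ∀ s t, M s t = coeff (Finsupp.single t 1) ((fun s => if s = j then
      q⁻¹ • MvPowerSeries.pderiv l f else if s = l then q⁻¹ • MvPowerSeries.pderiv j f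
      else (X s : MvPowerSeries (Fin n) κ)) s) := fun s t => rfl
  have hql : coeff (Finsupp.single l 1 + Finsupp.single j 1) f = q := by rw [add_comm, hq']
  have hE : ∀ s t, (M - 1) s t ≠ 0 → (s = j ∨ s = l) ∧ t ≠ j ∧ t ≠ l := by
    intro s t hst
    rw [Matrix.sub_apply, hMst, Matrix.one_apply] at hst
    by_cases hsj : s = j
    · refine ⟨Or.inl hsj, ?_, ?_⟩
      · intro htj
        rw [hsj, htj] at hst
        simp only [if_true, coeff_smul, coeff_single_pderiv, Finsupp.single_apply,
          if_neg hjl, Nat.cast_zero, zero_add, one_mul] at hst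
        exact hst (by rw [← hq', inv_mul_cancel₀ hq, sub_self])
      · intro htl
        rw [hsj, htl] at hst
        simp only [if_true, coeff_smul, coeff_single_pderiv, Finsupp.single_eq_same, h2,
          zero_mul, mul_zero, if_neg hjl, sub_zero] at hst
        exact hst rfl
    · by_cases hsl : s = l
      · refine ⟨Or.inr hsl, ?_, ?_⟩
        · intro htj
          rw [hsl, htj] at hst
          simp only [if_neg (Ne.symm hjl), if_true, coeff_smul, coeff_single_pderiv,
            Finsupp.single_eq_same, h2, zero_mul, mul_zero, sub_zero] at hst
          exact hst rfl
        · intro htl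
          rw [hsl, htl] at hst
          simp only [if_true, coeff_smul, coeff_single_pderiv, Finsupp.single_apply,
            if_neg (Ne.symm hjl), Nat.cast_zero, zero_add, one_mul, hql] at hst
          exact hst (by rw [inv_mul_cancel₀ hq, sub_self])
      · exfalso
        apply hst
        simp only [if_neg hsj, if_neg hsl, coeff_index_single_X]
        by_cases hts : t = s
        · subst hts; simp
        · rw [if_neg hts, if_neg (Ne.symm hts), sub_self]
  have hEE : (M - 1) * (M - 1) = 0 := by
    ext s t
    rw [Matrix.mul_apply, Matrix.zero_apply]
    refine Finset.sum_eq_zero fun u _ => ?_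
    by_cases hu : (M - 1) u t = 0
    · rw [hu, mul_zero]
    · have h1 := (hE u t hu).1
      by_cases hsu : (M - 1) s u = 0
      · rw [hsu, zero_mul]
      · have h3 := hE s u hsu
        rcases h1 with h1 | h1
        · exact absurd h1 h3.2.1
        · exact absurd h1 h3.2.2
  have hprod : M * (1 - (M - 1)) = 1 := by
    have : M * (1 - (M - 1)) = 1 - (M - 1) * (M - 1) := by noncomm_ring
    rw [this, hEE, sub_zero]
  have hdet := congrArg Matrix.det hprod
  rw [Matrix.det_mul, Matrix.det_one] at hdet
  exact IsUnit.of_mul_eq_one _ hdet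

/-- **REDUCTION OF A HYPERBOLIC PAIR** (characteristic two). If `f ∈ κ⟦X⟧` has no `X_j`, `X_l`
terms and `q = [X_j X_l] f ≠ 0` (`j ≠ l`), the substitution `X_j ↦ q⁻¹ ∂_l f`, `X_l ↦ q⁻¹ ∂_j f`,
`X_s ↦ X_s` is an automorphism `F`, and `f̃ = F⁻¹ f` has `X_l ∣ ∂_j f̃`, `X_j ∣ ∂_l f̃`,
`X_j, X_l ∈ (∂ f̃)` and `(∂ f) = F (∂ f̃)` (uses `∂_j ∂_j = 0`). [folklore] -/
theorem pair_reduction [CharP κ 2] {f : MvPowerSeries (Fin n) κ} {j l : Fin n} (hjl : j ≠ l)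
    (hq : coeff (Finsupp.single j 1 + Finsupp.single l 1) f ≠ 0)
    (hfj : coeff (Finsupp.single j 1) f = 0) (hfl : coeff (Finsupp.single l 1) f = 0) :
    ∃ F : MvPowerSeries (Fin n) κ ≃ₐ[κ] MvPowerSeries (Fin n) κ,
      (∀ s, constantCoeff ((fun s => if s = j then
        (coeff (Finsupp.single j 1 + Finsupp.single l 1) f)⁻¹ • MvPowerSeries.pderiv l f
        else if s = l then (coeff (Finsupp.single j 1 + Finsupp.single l 1) f)⁻¹ • MvPowerSeries.pderiv j f
        else X s) s) = 0) ∧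
      (∀ g, F g = subst (fun s => if s = j then
        (coeff (Finsupp.single j 1 + Finsupp.single l 1) f)⁻¹ • MvPowerSeries.pderiv l f
        else if s = l then (coeff (Finsupp.single j 1 + Finsupp.single l 1) f)⁻¹ • MvPowerSeries.pderiv j f
        else X s) g) ∧
      Ideal.span (Set.range fun s => MvPowerSeries.pderiv s f) =
        (Ideal.span (Set.range fun s => MvPowerSeries.pderiv s (F.symm f))).map
          (F : MvPowerSeries (Fin n) κ →+* MvPowerSeries (Fin n) κ) ∧
      (X l ∣ MvPowerSeries.pderiv j (F.symm f)) ∧ (X j ∣ MvPowerSeries.pderiv l (F.symm f)) ∧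
      X j ∈ Ideal.span (Set.range fun s => MvPowerSeries.pderiv s (F.symm f)) ∧
      X l ∈ Ideal.span (Set.range fun s => MvPowerSeries.pderiv s (F.symm f)) := by
  set q := coeff (Finsupp.single j 1 + Finsupp.single l 1) f with hq'
  set θ : Fin n → MvPowerSeries (Fin n) κ := fun s => if s = j then q⁻¹ • MvPowerSeries.pderiv l f
      else if s = l then q⁻¹ • MvPowerSeries.pderiv j f else X s with hθ
  have hθj : θ j = q⁻¹ • MvPowerSeries.pderiv l f := by simp [hθ]
  have hθl : θ l = q⁻¹ • MvPowerSeries.pderiv j f := by simp [hθ, Ne.symm hjl]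
  have hθs : ∀ s, s ≠ j → s ≠ l → θ s = X s := fun s hsj hsl => by simp [hθ, hsj, hsl]
  have h0 : ∀ s, constantCoeff (θ s) = 0 := by
    intro s
    by_cases hsj : s = j
    · rw [hsj, hθj, ← coeff_zero_eq_constantCoeff_apply, coeff_smul,
        coeff_zero_eq_constantCoeff_apply, constantCoeff_pderiv, hfl, mul_zero]
    · by_cases hsl : s = l
      · rw [hsl, hθl, ← coeff_zero_eq_constantCoeff_apply, coeff_smul,
          coeff_zero_eq_constantCoeff_apply, constantCoeff_pderiv, hfj, mul_zero]
      · rw [hθs s hsj hsl, constantCoeff_X]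
  obtain ⟨F, hF⟩ := exists_algEquiv_of_subst θ h0 (isUnit_det_linMat_pair hjl hq)
  have hθsub : HasSubst θ := hasSubst_of_constantCoeff_zero h0
  have hFX : ∀ s, F (X s) = θ s := fun s => by rw [hF, subst_X hθsub]
  set g := F.symm f with hg
  have hfg : f = F g := (F.apply_symm_apply f).symm
  -- chain rule
  have hcr : ∀ m, MvPowerSeries.pderiv m f =
      ∑ s, F (MvPowerSeries.pderiv s g) * MvPowerSeries.pderiv m (θ s) := by
    intro m
    conv_lhs => rw [hfg, hF]
    rw [MvPowerSeries.pderiv_subst h0]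
    simp only [hF]
  -- the unit `U = q⁻¹ ∂_j ∂_l f`
  set U := q⁻¹ • MvPowerSeries.pderiv j (MvPowerSeries.pderiv l f) with hU
  have hUunit : IsUnit U := by
    rw [isUnit_iff_constantCoeff, hU, ← coeff_zero_eq_constantCoeff_apply, coeff_smul,
      coeff_zero_eq_constantCoeff_apply, constantCoeff_pderiv, coeff_single_pderiv]
    have : (((Finsupp.single j 1 : Fin n →₀ ℕ) l : ℕ) : κ) + 1 = 1 := by
      simp [hjl]
    rw [this, one_mul, ← hq', inv_mul_cancel₀ hq]
    exact isUnit_one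
  obtain ⟨u, hu⟩ := hUunit
  -- splitting sums over `s` into `j`, `l` and the rest
  have hsplit : ∀ φ : Fin n → MvPowerSeries (Fin n) κ,
      ∑ s, φ s = φ j + φ l + ∑ s ∈ (Finset.univ.erase j).erase l, φ s := by
    intro φ
    rw [← Finset.add_sum_erase _ _ (Finset.mem_univ j), ← Finset.add_sum_erase _ _
      (Finset.mem_erase.mpr ⟨Ne.symm hjl, Finset.mem_univ l⟩), add_assoc]
  have hrest : ∀ s ∈ (Finset.univ.erase j).erase l, s ≠ j ∧ s ≠ l := fun s hs =>
    ⟨Finset.ne_of_mem_erase (Finset.mem_of_mem_erase hs), Finset.ne_of_mem_erase hs⟩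
  -- `∂_j f = F (∂_j g) * U`
  have hj' : MvPowerSeries.pderiv j f = F (MvPowerSeries.pderiv j g) * U := by
    rw [hcr j, hsplit, hθj, hθl, Derivation.map_smul, Derivation.map_smul, pderiv_pderiv_self,
      smul_zero, mul_zero, add_zero, Finset.sum_eq_zero, add_zero]
    intro s hs
    rw [hθs s (hrest s hs).1 (hrest s hs).2, MvPowerSeries.pderiv_X, if_neg (hrest s hs).1, mul_zero]
  -- `∂_l f = F (∂_l g) * U`
  have hl' : MvPowerSeries.pderiv l f = F (MvPowerSeries.pderiv l g) * U := by
    rw [hcr l, hsplit, hθj, hθl, Derivation.map_smul, Derivation.map_smul, pderiv_pderiv_self,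
      smul_zero, mul_zero, zero_add, Finset.sum_eq_zero, add_zero, pderiv_comm]
    intro s hs
    rw [hθs s (hrest s hs).1 (hrest s hs).2, MvPowerSeries.pderiv_X, if_neg (hrest s hs).2, mul_zero]
  -- `∂_m f` for the other indices
  have hm' : ∀ m, m ≠ j → m ≠ l → MvPowerSeries.pderiv m f =
      F (MvPowerSeries.pderiv j g) * (q⁻¹ • MvPowerSeries.pderiv m (MvPowerSeries.pderiv l f)) +
      F (MvPowerSeries.pderiv l g) * (q⁻¹ • MvPowerSeries.pderiv m (MvPowerSeries.pderiv j f)) +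
      F (MvPowerSeries.pderiv m g) := by
    intro m hmj hml
    rw [hcr m, hsplit, hθj, hθl, Derivation.map_smul, Derivation.map_smul, Finset.sum_eq_single m]
    · rw [hθs m hmj hml, MvPowerSeries.pderiv_X, if_pos rfl, mul_one]
    · intro s hs hsm
      rw [hθs s (hrest s hs).1 (hrest s hs).2, MvPowerSeries.pderiv_X, if_neg hsm, mul_zero]
    · intro h
      exact absurd (Finset.mem_erase.mpr ⟨hml, Finset.mem_erase.mpr ⟨hmj, Finset.mem_univ m⟩⟩) h
  -- solving for `F (∂_j g)`, `F (∂_l g)`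
  have hFj : F (MvPowerSeries.pderiv j g) = MvPowerSeries.pderiv j f * ↑u⁻¹ := by
    rw [hj', ← hu, Units.mul_inv_cancel_right]
  have hFl : F (MvPowerSeries.pderiv l g) = MvPowerSeries.pderiv l f * ↑u⁻¹ := by
    rw [hl', ← hu, Units.mul_inv_cancel_right]
  -- `∂_j f = q • F (X l)`, `∂_l f = q • F (X j)`
  have hjX : MvPowerSeries.pderiv j f = F (q • X l) := by
    rw [map_smul, hFX, hθl, smul_smul, mul_inv_cancel₀ hq, one_smul]
  have hlX : MvPowerSeries.pderiv l f = F (q • X j) := by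
    rw [map_smul, hFX, hθj, smul_smul, mul_inv_cancel₀ hq, one_smul]
  have hgj : MvPowerSeries.pderiv j g = (q • X l) * F.symm ↑u⁻¹ := by
    apply F.injective
    rw [map_mul, F.apply_symm_apply, ← hjX, hFj]
  have hgl : MvPowerSeries.pderiv l g = (q • X j) * F.symm ↑u⁻¹ := by
    apply F.injective
    rw [map_mul, F.apply_symm_apply, ← hlX, hFl]
  have hXl : X l = q⁻¹ • (MvPowerSeries.pderiv j g * F.symm ↑u) := by
    rw [hgj, mul_assoc, ← map_mul, Units.inv_mul, map_one, mul_one, smul_smul,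
      inv_mul_cancel₀ hq, one_smul]
  have hXj : X j = q⁻¹ • (MvPowerSeries.pderiv l g * F.symm ↑u) := by
    rw [hgl, mul_assoc, ← map_mul, Units.inv_mul, map_one, mul_one, smul_smul,
      inv_mul_cancel₀ hq, one_smul]
  have hmem : ∀ s, MvPowerSeries.pderiv s g ∈
      Ideal.span (Set.range fun s => MvPowerSeries.pderiv s g) := fun s => Ideal.subset_span ⟨s, rfl⟩
  refine ⟨F, h0, hF, ?_, ⟨q • F.symm ↑u⁻¹, by rw [hgj, smul_mul_assoc, mul_smul_comm]⟩,
    ⟨q • F.symm ↑u⁻¹, by rw [hgl, smul_mul_assoc, mul_smul_comm]⟩,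
    by rw [hXj]; exact Submodule.smul_of_tower_mem _ _ (Ideal.mul_mem_right _ _ (hmem l)),
    by rw [hXl]; exact Submodule.smul_of_tower_mem _ _ (Ideal.mul_mem_right _ _ (hmem j))⟩
  -- the two Jacobian ideals
  rw [Ideal.map_span, ← Set.range_comp]
  have hmem' : ∀ s, (F : MvPowerSeries (Fin n) κ →+* MvPowerSeries (Fin n) κ) (MvPowerSeries.pderiv s g) ∈
      Ideal.span (Set.range ((F : MvPowerSeries (Fin n) κ →+* MvPowerSeries (Fin n) κ) ∘
        fun s => MvPowerSeries.pderiv s g)) := fun s => Ideal.subset_span ⟨s, rfl⟩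
  have hmemf : ∀ s, MvPowerSeries.pderiv s f ∈
      Ideal.span (Set.range fun s => MvPowerSeries.pderiv s f) := fun s => Ideal.subset_span ⟨s, rfl⟩
  apply le_antisymm
  · rw [Ideal.span_le]
    rintro _ ⟨m, rfl⟩
    show MvPowerSeries.pderiv m f ∈ _
    by_cases hmj : m = j
    · subst hmj
      rw [hj']
      exact Ideal.mul_mem_right _ _ (hmem' m)
    · by_cases hml : m = l
      · subst hml
        rw [hl']
        exact Ideal.mul_mem_right _ _ (hmem' m)
      · rw [hm' m hmj hml]
        exact Ideal.add_mem _ (Ideal.add_mem _ (Ideal.mul_mem_right _ _ (hmem' j))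
          (Ideal.mul_mem_right _ _ (hmem' l))) (hmem' m)
  · rw [Ideal.span_le]
    rintro _ ⟨m, rfl⟩
    show F (MvPowerSeries.pderiv m g) ∈ _
    by_cases hmj : m = j
    · subst hmj
      rw [hFj]
      exact Ideal.mul_mem_right _ _ (hmemf m)
    · by_cases hml : m = l
      · subst hml
        rw [hFl]
        exact Ideal.mul_mem_right _ _ (hmemf m)
      · have : F (MvPowerSeries.pderiv m g) = MvPowerSeries.pderiv m f -
            F (MvPowerSeries.pderiv j g) * (q⁻¹ • MvPowerSeries.pderiv m (MvPowerSeries.pderiv l f)) -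
            F (MvPowerSeries.pderiv l g) * (q⁻¹ • MvPowerSeries.pderiv m (MvPowerSeries.pderiv j f)) := by
          rw [hm' m hmj hml]; ring
        rw [this, hFj, hFl]
        exact Ideal.sub_mem _ (Ideal.sub_mem _ (hmemf m) (Ideal.mul_mem_right _ _
          (Ideal.mul_mem_right _ _ (hmemf j)))) (Ideal.mul_mem_right _ _
          (Ideal.mul_mem_right _ _ (hmemf l)))

end Reduction

end MuDropCharTwoOrdP

end Summit.ResolutionOfSingularities.ResolutionOfSingularities.Theorems.WildCones

end
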